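import Summits.CriticalPhenomena.PercolationContinuityZ3.Theorems.PercNearOneGluingNoHeavyLowerTailIncStarTwoCutBPlusLimit
import HarnessLib

/-!
# Two-cuts with the root and one target on the root side (MODE B), XXVI: the induction step (COROLLARY M″)

Support file for the Sahi programme (`--supports stmt-CriticalPhenomena-4575`, prover prim-sahi-p2 gen 28).  No definitions, no named facts,
no sorries; standard axioms plus the computational ancestry of part XXIV.

`incStar_twoCut_reduce`: let `R ∋ s` be a finite root side, `u ≠ v` outside `R` with no positive pair from `R` to the outside of `R ∪ {u, v}`,
the outside of `R ∪ {u, v}` nonempty, one target `a ∈ R ∪ {u, v}` and the other two `b, c ∉ R`.  If the increasing star holds inside every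
vertex set of size `< n` for every weight (induction hypothesis), then it holds at `(a, b, c)`.  The two far stars of THEOREM B⁺
(`incStar_nonneg_of_twoCut_farStars'`) are the hypothesis inside `Rᶜ`; the near star for a weakened weight `w'` is the hypothesis inside
`R ∪ {u, v}` for the weight `w'·1_F` restricted to the root-side pairs (`sahiE3_rootSide_eq_restrict`, then no pair leaves `R ∪ {u, v}`).
Consequence (COROLLARY M″, `…IncStarIrreducibleFour`): a minimal counterexample to the increasing star has no two-separator `{u, v} ∌ s`
whose root side carries at most one target while two targets lie off the root side and something lies strictly beyond `R ∪ {u, v}`.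
-/

noncomputable section

namespace Summit.CriticalPhenomena.PercolationContinuityZ3.Theorems

namespace IncStarTwoCut

open MeasureTheory Set Literature.Probability.Percolation Literature.Probability.LatticeModels
open scoped Classical

variable {n : ℕ}

/-- `E₃` of three root-side events (`ω ∩ F ∈ ·`) is `E₃` of the plain events under the weight restricted to `F`. [this work] -/
theorem sahiE3_rootSide_eq_restrict (w wF : Sym2 (Fin n) → unitInterval) (F : Set (Sym2 (Fin n)))
    (hwF : ∀ e, (e ∈ F → wF e = w e) ∧ (e ∉ F → wF e = 0)) (A B C : Set (BondConfig (Fin n))) :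
    sahiE3 (prodBernoulli w) {ω | ω ∩ F ∈ A} {ω | ω ∩ F ∈ B} {ω | ω ∩ F ∈ C} = sahiE3 (prodBernoulli wF) A B C := by
  obtain rfl : wF = fun e => if e ∈ F then w e else 0 := by
    funext e
    by_cases he : e ∈ F
    · rw [if_pos he]; exact (hwF e).1 he
    · rw [if_neg he]; exact (hwF e).2 he
  have h := real_rootSide_eq_restrict w F
  have iAB : ({ω | ω ∩ F ∈ A} ∩ {ω | ω ∩ F ∈ B} : Set (BondConfig (Fin n))) = {ω | ω ∩ F ∈ A ∩ B} := Set.ext fun _ => Iff.rfl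
  have iAC : ({ω | ω ∩ F ∈ A} ∩ {ω | ω ∩ F ∈ C} : Set (BondConfig (Fin n))) = {ω | ω ∩ F ∈ A ∩ C} := Set.ext fun _ => Iff.rfl
  have iBC : ({ω | ω ∩ F ∈ B} ∩ {ω | ω ∩ F ∈ C} : Set (BondConfig (Fin n))) = {ω | ω ∩ F ∈ B ∩ C} := Set.ext fun _ => Iff.rfl
  have iABC : ({ω | ω ∩ F ∈ A ∩ B} ∩ {ω | ω ∩ F ∈ C} : Set (BondConfig (Fin n))) = {ω | ω ∩ F ∈ A ∩ B ∩ C} :=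
    Set.ext fun _ => Iff.rfl
  rw [sahiE3_def, sahiE3_def, iAB, iAC, iBC, iABC, h, h, h, h, h, h, h]

/-- **Reduction across a two-cut with the root and at most one target on the root side (COROLLARY M″, induction step).** [this work] -/
theorem incStar_twoCut_reduce (w : Sym2 (Fin n) → unitInterval) (R : Finset (Fin n)) {s u v a b c : Fin n}
    (hs : s ∈ R) (hu : u ∉ R) (hv : v ∉ R) (huv : u ≠ v) (ha : a ∈ R ∨ a = u ∨ a = v) (hb : b ∉ R) (hc : c ∉ R)
    (hfar : ∃ z, z ∉ R ∧ z ≠ u ∧ z ≠ v)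
    (hw : ∀ x ∈ R, ∀ z, z ∉ R → z ≠ u → z ≠ v → w s(x, z) = 0)
    (IH : ∀ (w' : Sym2 (Fin n) → unitInterval) (S : Finset (Fin n)), S.card < n → ∀ {x t₁ t₂ t₃ : Fin n},
        x ∈ S → t₁ ∈ S → t₂ ∈ S → t₃ ∈ S →
        0 ≤ sahiE3 (prodBernoulli w') (openConnIn (↑S : Set (Fin n)) x t₁) (openConnIn (↑S : Set (Fin n)) x t₂)
          (openConnIn (↑S : Set (Fin n)) x t₃)) :
    0 ≤ sahiE3 (prodBernoulli w) (openConn s a) (openConn s b) (openConn s c) := by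
  have hcardn : Fintype.card (Fin n) = n := Fintype.card_fin n
  -- the far stars: the induction hypothesis inside `Rᶜ`
  set S : Finset (Fin n) := Finset.univ \ R with hSdef
  have memS : ∀ {p : Fin n}, p ∉ R → p ∈ S := fun hp => Finset.mem_sdiff.2 ⟨Finset.mem_univ _, hp⟩
  have hS : (↑S : Set (Fin n)) = (↑R : Set (Fin n))ᶜ := by ext p; simp [hSdef]
  have hScard : S.card < n := by
    have : s ∉ S := fun h => (Finset.mem_sdiff.1 h).2 hs
    simpa [hcardn] using Finset.card_lt_univ_of_notMem this
  have hSu := IH w S hScard (memS hu) (memS hv) (memS hb) (memS hc)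
  have hSv := IH w S hScard (memS hv) (memS hu) (memS hb) (memS hc)
  rw [hS] at hSu hSv
  -- the near side `R ∪ {u, v}`
  set N : Finset (Fin n) := R ∪ {u, v} with hNdef
  have memN : ∀ {p : Fin n}, p ∈ N ↔ p ∈ R ∨ p = u ∨ p = v := fun {p} => by simp only [hNdef, Finset.mem_union, Finset.mem_insert, Finset.mem_singleton]
  have hNcard : N.card < n := by
    obtain ⟨z, hzR, hzu, hzv⟩ := hfar
    have : z ∉ N := fun h => by rcases memN.1 h with h | h | h; exacts [hzR h, hzu h, hzv h]
    simpa [hcardn] using Finset.card_lt_univ_of_notMem this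
  refine incStar_nonneg_of_twoCut_farStars' w (↑R : Set (Fin n)) (Finset.mem_coe.2 hs) ?_ (fun h => hb (Finset.mem_coe.1 h))
    (fun h => hc (Finset.mem_coe.1 h)) (fun h => hu (Finset.mem_coe.1 h)) (fun h => hv (Finset.mem_coe.1 h)) huv
    (fun x hx z hz hzu hzv => hw x (Finset.mem_coe.1 hx) z (fun h => hz (Finset.mem_coe.2 h)) hzu hzv) rfl rfl rfl rfl ?_ hSu hSv
  · rcases ha with h | h | h
    · exact Or.inl (Finset.mem_coe.2 h)
    · exact Or.inr (Or.inl h)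
    · exact Or.inr (Or.inr h)
  -- the near star for every weakening `w'` of `w` on the root-side pairs
  intro w' hoff hle
  set F : Set (Sym2 (Fin n)) := {e : Sym2 (Fin n) | ∃ y ∈ (↑R : Set (Fin n)), y ∈ e} with hFdef
  obtain ⟨wF, hwF⟩ : ∃ wF : Sym2 (Fin n) → unitInterval, ∀ e, (e ∈ F → wF e = w' e) ∧ (e ∉ F → wF e = 0) :=
    ⟨fun e => if e ∈ F then w' e else 0, fun e => ⟨fun h => if_pos h, fun h => if_neg h⟩⟩
  rw [sahiE3_rootSide_eq_restrict w' wF F hwF]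
  -- no positive pair of `wF` leaves `N`
  have hexit : ∀ y ∈ (↑N : Set (Fin n)), ∀ z ∉ (↑N : Set (Fin n)), wF s(y, z) = 0 := by
    intro y hy z hz
    have hy' := memN.1 (Finset.mem_coe.1 hy)
    have hz' : z ∉ R ∧ z ≠ u ∧ z ≠ v := by
      refine ⟨fun h => hz (Finset.mem_coe.2 (memN.2 (Or.inl h))), fun h => hz (Finset.mem_coe.2 (memN.2 (Or.inr (Or.inl h)))),
        fun h => hz (Finset.mem_coe.2 (memN.2 (Or.inr (Or.inr h))))⟩
    by_cases hyR : y ∈ R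
    · have hmem : s(y, z) ∈ F := ⟨y, Finset.mem_coe.2 hyR, Sym2.mem_mk_left y z⟩
      have h0 : w s(y, z) = 0 := hw y hyR z hz'.1 hz'.2.1 hz'.2.2
      have hle' := hle _ hmem
      rw [h0] at hle'
      rw [(hwF _).1 hmem]
      exact Subtype.ext (le_antisymm (by simpa using hle') (w' s(y, z)).2.1)
    · have hnot : s(y, z) ∉ F := by
        rintro ⟨t, ht, hte⟩
        rcases Sym2.mem_iff.1 hte with rfl | rfl
        · exact hyR (Finset.mem_coe.1 ht)
        · exact hz'.1 (Finset.mem_coe.1 ht)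
      exact (hwF _).2 hnot
  have hsN : s ∈ N := memN.2 (Or.inl hs)
  rw [IncStarIrreducible.sahiE3_openConn_eq_openConnIn_of_no_exit wF (↑N) hexit (Finset.mem_coe.2 hsN)]
  exact IH wF N hNcard hsN (memN.2 ha) (memN.2 (Or.inr (Or.inl rfl))) (memN.2 (Or.inr (Or.inr rfl)))

end IncStarTwoCut

end Summit.CriticalPhenomena.PercolationContinuityZ3.Theorems

end
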